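import Summits.Ventures.YMGap.Thresholds.OneLinkPsiTwoGradient
import Summits.Ventures.YMGap.Thresholds.OneLinkLevelTwoCovariance
import HarnessLib

/-!
# Venture YMGap — the one-link modulus beyond first order, part 8: the `L²(ν_B)` gradient norm of `ψ₂` (Minkowski step)

HONEST FRAMING: venture file of the cell `pub-ymgap` (QuantumFields programme), strong-coupling LATTICE bookkeeping for `SU(N)`
lattice Yang–Mills; nothing about the continuum or the mass gap in the Clay sense.  No number of record («F5», part 1b, of the cell
note `HOME/p2/ONE-LINK-HIERARCHY.md` §4 (4.5)).

WHAT.  From the pointwise bound `Γ(ψ₂,ψ₂)(g) ≤ (a + κ₁‖Δ‖_F‖tr(gB)‖ + κ₁‖B‖_F‖tr(gΔ)‖)²` (`Gam_psiTwo_le`, `a = 2κ_w‖B‖_op‖Δ‖_F`) and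
Minkowski's inequality in `L²(ν_B)` (`sqrt_integral_add_sq_le`, from the tree's Cauchy–Schwarz `abs_integral_mul_le_sqrt`):
  `√(∫ Γ(ψ₂,ψ₂) dν_B) ≤ 2κ_w‖B‖_op‖Δ‖_F + κ₁ ( ‖Δ‖_F √(∫ ‖tr(gB)‖² dν_B) + ‖B‖_F √(∫ ‖tr(gΔ)‖² dν_B) )`
(`sqrt_integral_Gam_psiTwo_le`).  The two second moments are then bounded by the Schwinger–Dyson means (`OneLinkSDMeans`) and the joint
fluctuation scale (`OneLinkFluctuations`): `√(∫‖tr(gM)‖²dν) ≤ ‖E tr(gM)‖ + ‖M‖_F/√ρ`.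

References: cell note `HOME/p2/ONE-LINK-HIERARCHY.md` §4 (4.5).
-/

noncomputable section

open scoped Matrix ComplexConjugate BigOperators ContDiff Matrix.Norms.Frobenius
open Matrix Complex Finset MeasureTheory ProbabilityTheory
open Literature.MathematicalPhysics.QuantumFieldTheory
open Literature.MathematicalPhysics.QuantumFieldTheory.SUNBakryEmery

namespace Summit.Ventures.YMGap.OneLinkEigen

variable {N : ℕ}

/-- **Minkowski in `L²`** for continuous functions on `SU(N)` under a finite measure:
`√(∫ (f+h)²) ≤ √(∫ f²) + √(∫ h²)`. [folklore] -/
theorem sqrt_integral_add_sq_le {f h : SUN N → ℝ} (hf : Continuous f) (hh : Continuous h) (μ : Measure (SUN N))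
    [IsFiniteMeasure μ] :
    Real.sqrt (∫ x, (f x + h x) ^ 2 ∂μ) ≤ Real.sqrt (∫ x, f x ^ 2 ∂μ) + Real.sqrt (∫ x, h x ^ 2 ∂μ) := by
  set Af : ℝ := ∫ x, f x ^ 2 ∂μ with hAf
  set Ah : ℝ := ∫ x, h x ^ 2 ∂μ with hAh
  have hAf0 : 0 ≤ Af := integral_nonneg fun x => sq_nonneg _
  have hAh0 : 0 ≤ Ah := integral_nonneg fun x => sq_nonneg _
  have hcs := abs_integral_mul_le_sqrt hf hh μ
  have i1 : Integrable (fun x => f x ^ 2) μ := integrable_of_continuous_SUN (hf.pow 2) μ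
  have i2 : Integrable (fun x => h x ^ 2) μ := integrable_of_continuous_SUN (hh.pow 2) μ
  have i3 : Integrable (fun x => f x * h x) μ := integrable_of_continuous_SUN (hf.mul hh) μ
  have hexp : ∫ x, (f x + h x) ^ 2 ∂μ = Af + 2 * ∫ x, f x * h x ∂μ + Ah := by
    have : (fun x => (f x + h x) ^ 2) = fun x => f x ^ 2 + 2 * (f x * h x) + h x ^ 2 := by funext x; ring
    have i13 : Integrable (fun x => f x ^ 2 + 2 * (f x * h x)) μ := i1.add (i3.const_mul 2)
    rw [this, integral_add i13 i2, integral_add i1 (i3.const_mul 2), integral_const_mul]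
  have hle : ∫ x, (f x + h x) ^ 2 ∂μ ≤ (Real.sqrt Af + Real.sqrt Ah) ^ 2 := by
    rw [hexp, add_sq, Real.sq_sqrt hAf0, Real.sq_sqrt hAh0]
    have := (abs_le.1 hcs).2
    nlinarith
  calc Real.sqrt (∫ x, (f x + h x) ^ 2 ∂μ) ≤ Real.sqrt ((Real.sqrt Af + Real.sqrt Ah) ^ 2) := Real.sqrt_le_sqrt hle
    _ = Real.sqrt Af + Real.sqrt Ah := Real.sqrt_sq (add_nonneg (Real.sqrt_nonneg _) (Real.sqrt_nonneg _))

/-- From a pointwise bound `0 ≤ F ≤ (a + b + c)²` with `a ≥ 0` constant and `b, c ≥ 0` continuous, on a probability measure: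
`√(∫ F) ≤ a + √(∫ b²) + √(∫ c²)`. [folklore] -/
theorem sqrt_integral_le_of_le_add_sq {F b c : SUN N → ℝ} {a : ℝ} (hF : Continuous F) (hb : Continuous b) (hc : Continuous c)
    (ha : 0 ≤ a) (hle : ∀ x, F x ≤ (a + b x + c x) ^ 2)
    (μ : Measure (SUN N)) [IsProbabilityMeasure μ] :
    Real.sqrt (∫ x, F x ∂μ) ≤ a + Real.sqrt (∫ x, b x ^ 2 ∂μ) + Real.sqrt (∫ x, c x ^ 2 ∂μ) := by
  have h1 : ∫ x, F x ∂μ ≤ ∫ x, ((fun _ => a) x + (b x + c x)) ^ 2 ∂μ :=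
    integral_mono (integrable_of_continuous_SUN hF μ)
      (integrable_of_continuous_SUN ((continuous_const.add (hb.add hc)).pow 2) μ) fun x => by
        simpa [add_assoc] using hle x
  calc Real.sqrt (∫ x, F x ∂μ) ≤ Real.sqrt (∫ x, ((fun _ => a) x + (b x + c x)) ^ 2 ∂μ) := Real.sqrt_le_sqrt h1
    _ ≤ Real.sqrt (∫ x, (fun _ : SUN N => a) x ^ 2 ∂μ) + Real.sqrt (∫ x, (b x + c x) ^ 2 ∂μ) :=
        sqrt_integral_add_sq_le continuous_const (hb.add hc) μ
    _ ≤ a + (Real.sqrt (∫ x, b x ^ 2 ∂μ) + Real.sqrt (∫ x, c x ^ 2 ∂μ)) := by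
        refine add_le_add ?_ (sqrt_integral_add_sq_le hb hc μ)
        simp [Real.sqrt_sq ha]
    _ = _ := by ring

/-- **The `L²(ν_B)` gradient norm of `ψ₂`**:
`√(∫ Γ(ψ₂,ψ₂) dν_B) ≤ 2κ_w ‖B‖_op ‖Δ‖_F + κ₁ ( ‖Δ‖_F √(∫ ‖tr(gB)‖² dν_B) + ‖B‖_F √(∫ ‖tr(gΔ)‖² dν_B) )`,
`κ_w = N²/(4(N²−4))`, `κ₁ = N/(2(N²−4)) + 1/(4N)`. [folklore] -/
theorem sqrt_integral_Gam_psiTwo_le (hN : 3 ≤ N) (B Δ : Matrix (Fin N) (Fin N) ℂ) :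
    Real.sqrt (∫ g, Gam (fun Q : Matrix (Fin N) (Fin N) ℂ =>
          -((N : ℝ) ^ 2 / (4 * ((N : ℝ) ^ 2 - 4))) * (Q * Δ * Q * B).trace.re
            + ((N : ℝ) / (2 * ((N : ℝ) ^ 2 - 4))) * ((Q * B).trace * (Q * Δ).trace).re
            - (1 / (4 * (N : ℝ))) * ((Q * B).trace * (starRingEnd ℂ) (Q * Δ).trace).re)
        (fun Q : Matrix (Fin N) (Fin N) ℂ =>
          -((N : ℝ) ^ 2 / (4 * ((N : ℝ) ^ 2 - 4))) * (Q * Δ * Q * B).trace.re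
            + ((N : ℝ) / (2 * ((N : ℝ) ^ 2 - 4))) * ((Q * B).trace * (Q * Δ).trace).re
            - (1 / (4 * (N : ℝ))) * ((Q * B).trace * (starRingEnd ℂ) (Q * Δ).trace).re) g
        ∂(haarProbability (SUN N)).tilted (fun g => (N : ℝ) * ((g : Matrix (Fin N) (Fin N) ℂ) * B).trace.re)) ≤
      (N : ℝ) ^ 2 / (4 * ((N : ℝ) ^ 2 - 4)) * (2 * matrixOpNorm B * frobNorm Δ)
        + ((N : ℝ) / (2 * ((N : ℝ) ^ 2 - 4)) + 1 / (4 * (N : ℝ))) * frobNorm Δ *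
          Real.sqrt (∫ g, ‖((g : Matrix (Fin N) (Fin N) ℂ) * B).trace‖ ^ 2
            ∂(haarProbability (SUN N)).tilted (fun g => (N : ℝ) * ((g : Matrix (Fin N) (Fin N) ℂ) * B).trace.re))
        + ((N : ℝ) / (2 * ((N : ℝ) ^ 2 - 4)) + 1 / (4 * (N : ℝ))) * frobNorm B *
          Real.sqrt (∫ g, ‖((g : Matrix (Fin N) (Fin N) ℂ) * Δ).trace‖ ^ 2
            ∂(haarProbability (SUN N)).tilted (fun g => (N : ℝ) * ((g : Matrix (Fin N) (Fin N) ℂ) * B).trace.re)) := by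
  have h3 : (3 : ℝ) ≤ N := by exact_mod_cast hN
  have hN4 : (0 : ℝ) < (N : ℝ) ^ 2 - 4 := by nlinarith
  have hNpos : (0 : ℝ) < N := by linarith
  set κw : ℝ := (N : ℝ) ^ 2 / (4 * ((N : ℝ) ^ 2 - 4)) with hκw
  set κ1 : ℝ := (N : ℝ) / (2 * ((N : ℝ) ^ 2 - 4)) + 1 / (4 * (N : ℝ)) with hκ1
  have hκw0 : 0 ≤ κw := by positivity
  have hκ10 : 0 ≤ κ1 := by positivity
  set ν : Measure (SUN N) :=
    (haarProbability (SUN N)).tilted (fun g => (N : ℝ) * ((g : Matrix (Fin N) (Fin N) ℂ) * B).trace.re) with hν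
  have hexpi : Integrable (fun g : SUN N => Real.exp ((N : ℝ) * ((g : Matrix (Fin N) (Fin N) ℂ) * B).trace.re))
      (haarProbability (SUN N)) :=
    integrable_of_continuous_SUN (Real.continuous_exp.comp (continuous_restrict (contDiff_pot (N : ℝ) B))) _
  haveI : IsProbabilityMeasure ν := isProbabilityMeasure_tilted hexpi
  have hψ := contDiff_psiTwo N B Δ
  -- pointwise bound in the shape `(a + b + c)²`
  set b : SUN N → ℝ := fun g => κ1 * frobNorm Δ * ‖((g : Matrix (Fin N) (Fin N) ℂ) * B).trace‖ with hb
  set c : SUN N → ℝ := fun g => κ1 * frobNorm B * ‖((g : Matrix (Fin N) (Fin N) ℂ) * Δ).trace‖ with hc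
  have htr : ∀ M : Matrix (Fin N) (Fin N) ℂ, Continuous fun g : SUN N => ((g : Matrix (Fin N) (Fin N) ℂ) * M).trace :=
    fun M => (continuous_subtype_val.matrix_mul continuous_const).matrix_trace
  have hbc : Continuous b := continuous_const.mul (continuous_norm.comp (htr B))
  have hcc : Continuous c := continuous_const.mul (continuous_norm.comp (htr Δ))
  have ha0 : 0 ≤ κw * (2 * matrixOpNorm B * frobNorm Δ) :=
    mul_nonneg hκw0 (mul_nonneg (mul_nonneg (by norm_num) (matrixOpNorm_nonneg B)) (frobNorm_nonneg Δ))
  have key := sqrt_integral_le_of_le_add_sq (a := κw * (2 * matrixOpNorm B * frobNorm Δ))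
    (continuous_restrict (contDiff_Gam hψ hψ)) hbc hcc ha0 (fun g => ?_) ν
  · have eb : Real.sqrt (∫ x, b x ^ 2 ∂ν) = κ1 * frobNorm Δ *
        Real.sqrt (∫ g, ‖((g : Matrix (Fin N) (Fin N) ℂ) * B).trace‖ ^ 2 ∂ν) := by
      have : (fun x => b x ^ 2) = fun g : SUN N => (κ1 * frobNorm Δ) ^ 2 * ‖((g : Matrix (Fin N) (Fin N) ℂ) * B).trace‖ ^ 2 := by
        funext g; simp only [hb]; ring
      rw [this, integral_const_mul, Real.sqrt_mul (sq_nonneg _), Real.sqrt_sq (mul_nonneg hκ10 (frobNorm_nonneg Δ))]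
    have ec : Real.sqrt (∫ x, c x ^ 2 ∂ν) = κ1 * frobNorm B *
        Real.sqrt (∫ g, ‖((g : Matrix (Fin N) (Fin N) ℂ) * Δ).trace‖ ^ 2 ∂ν) := by
      have : (fun x => c x ^ 2) = fun g : SUN N => (κ1 * frobNorm B) ^ 2 * ‖((g : Matrix (Fin N) (Fin N) ℂ) * Δ).trace‖ ^ 2 := by
        funext g; simp only [hc]; ring
      rw [this, integral_const_mul, Real.sqrt_mul (sq_nonneg _), Real.sqrt_sq (mul_nonneg hκ10 (frobNorm_nonneg B))]
    rw [eb, ec] at key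
    exact key
  · have h := Gam_psiTwo_le hN B Δ g
    simp only [hb, hc]
    calc _ ≤ _ := h
      _ = _ := by ring

end Summit.Ventures.YMGap.OneLinkEigen
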